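import Mathlib
import Summits.Ventures.PercRepro2.V2SP
import Summits.Ventures.PercRepro2.HallOffFrame
import Summits.Ventures.PercRepro2.HallOffAxis
import Summits.Ventures.PercRepro2.Tail2DCount
import Summits.Ventures.PercRepro2.Tail2DThreePoint
import Summits.Ventures.PercRepro2.Tail2DP2Series
import Summits.Ventures.PercRepro2.Tail2DDisjointPaths
import Summits.Ventures.PercRepro2.Tail2DP2SeriesSP
import Summits.Ventures.PercRepro2.Tail2DAxisUnimodal
import Summits.Ventures.PercRepro2.Tail2DOffAxis31
import Summits.Ventures.PercRepro2.Tail2DRowOne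
import Summits.Ventures.PercRepro2.Tail2DStepRowZero
import Summits.Ventures.PercRepro2.Tail2DStepCert

/-!
# Certified off-axis members: the toolbox (seat mine-b, cell pub-perc-repro2; MINE-B.md §37.8)

The off-axis member `(a, j)` — `T(a,j) ≤ T(a−1,j+1)` — is the sign of the count of the weight
`phi a j r b = [r+1 = a ∧ j+1 ≤ b] − [a ≤ r ∧ b = j]` (`offaxis_iff`, the general form of `row_iff`); the
offset-one weights `phi (j+1) j` have count `0` (the colour swap, `sum_phi_offset_one_zero`); and the
weight of a sum of labels depends only on the labels capped at `K` (`phi_cap_sum`), so that a pointwise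
certificate of the parallel step can be decided by the kernel exactly as for the STEP members.
-/

namespace Summit.Ventures.PercRepro2.Tail2D

open V2Closure

section Counts

variable (s : V2Closure.SP)

/-- the count of the off-axis weight: `Σ phi a j = #{r + 1 = a ∧ b ≥ j+1} − #{r ≥ a ∧ b = j}` -/
lemma sum_phi_eq' (a j : ℕ) :
    ∑ x, phi a j (s.rLab x) (s.bLab x)
      = ((Finset.univ.filter (fun y : s.Conf => s.rLab y + 1 = a ∧ j + 1 ≤ s.bLab y)).card : ℤ)
        - ((Finset.univ.filter (fun y : s.Conf => a ≤ s.rLab y ∧ s.bLab y = j)).card : ℤ) := by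
  rw [Finset.card_filter, Finset.card_filter]
  push_cast
  rw [← Finset.sum_sub_distrib]
  refine Finset.sum_congr rfl (fun y _ => ?_)
  unfold phi
  split_ifs <;> omega

/-- `T(a,j) = #{r ≥ a ∧ b = j} + #{r ≥ a ∧ b ≥ j+1}` -/
lemma card_tail_split_b (a j : ℕ) :
    (Finset.univ.filter (fun y : s.Conf => a ≤ s.rLab y ∧ j ≤ s.bLab y)).card
      = (Finset.univ.filter (fun y : s.Conf => a ≤ s.rLab y ∧ s.bLab y = j)).card
        + (Finset.univ.filter (fun y : s.Conf => a ≤ s.rLab y ∧ j + 1 ≤ s.bLab y)).card := by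
  rw [Finset.card_filter, Finset.card_filter, Finset.card_filter, ← Finset.sum_add_distrib]
  refine Finset.sum_congr rfl (fun y _ => ?_)
  split_ifs <;> omega

/-- `T(a−1,j+1) = #{r + 1 = a ∧ b ≥ j+1} + #{r ≥ a ∧ b ≥ j+1}` for `a ≥ 1` -/
lemma card_tail_split_r (a j : ℕ) (ha : 1 ≤ a) :
    (Finset.univ.filter (fun y : s.Conf => a - 1 ≤ s.rLab y ∧ j + 1 ≤ s.bLab y)).card
      = (Finset.univ.filter (fun y : s.Conf => s.rLab y + 1 = a ∧ j + 1 ≤ s.bLab y)).card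
        + (Finset.univ.filter (fun y : s.Conf => a ≤ s.rLab y ∧ j + 1 ≤ s.bLab y)).card := by
  rw [Finset.card_filter, Finset.card_filter, Finset.card_filter, ← Finset.sum_add_distrib]
  refine Finset.sum_congr rfl (fun y _ => ?_)
  split_ifs <;> omega

/-- the off-axis member `(a, j)` and the sign of the count of `phi a j` -/
lemma offaxis_iff (a j : ℕ) (ha : 1 ≤ a) :
    (Finset.univ.filter (fun y : s.Conf => a ≤ s.rLab y ∧ j ≤ s.bLab y)).card
        ≤ (Finset.univ.filter (fun y : s.Conf => a - 1 ≤ s.rLab y ∧ j + 1 ≤ s.bLab y)).card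
      ↔ 0 ≤ ∑ x, phi a j (s.rLab x) (s.bLab x) := by
  rw [sum_phi_eq', card_tail_split_b, card_tail_split_r s a j ha]
  constructor <;> intro h <;> omega

/-- the offset-one weight `phi (j+1) j` has count `0`: it is the swap difference of `[r = j ∧ b ≥ j+1]` -/
lemma sum_phi_offset_one_zero (j : ℕ) : ∑ x, phi (j + 1) j (s.rLab x) (s.bLab x) = 0 := by
  have h := sum_antisymm_zero s (fun a c => if a = j ∧ j + 1 ≤ c then (1 : ℤ) else 0)
  have e : ∑ x, phi (j + 1) j (s.rLab x) (s.bLab x)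
      = ∑ x, ((if s.rLab x = j ∧ j + 1 ≤ s.bLab x then (1 : ℤ) else 0)
          - (if s.bLab x = j ∧ j + 1 ≤ s.rLab x then (1 : ℤ) else 0)) := by
    refine Finset.sum_congr rfl (fun x _ => ?_)
    unfold phi
    split_ifs <;> omega
  rw [e, h]

end Counts

/-- the off-axis weight of the sums of labels depends only on the capped labels (`a ≤ K`, `j + 1 ≤ K`) -/
lemma phi_cap_sum (a j K r b u v : ℕ) (ha : a ≤ K) (hj : j + 1 ≤ K) :
    phi a j (min r K + min u K) (min b K + min v K) = phi a j (r + u) (b + v) := by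
  unfold phi; split_ifs <;> omega

/-- the empty tail of an off-axis member on an atom (`r ≤ 1 < a`) -/
lemma offaxis_atom (s : V2Closure.SP) (hs : s = .free ∨ s = .pin ∨ s = .absent) (a j : ℕ) (ha : 2 ≤ a) :
    (Finset.univ.filter (fun y : s.Conf => a ≤ s.rLab y ∧ j ≤ s.bLab y)).card
      ≤ (Finset.univ.filter (fun y : s.Conf => a - 1 ≤ s.rLab y ∧ j + 1 ≤ s.bLab y)).card := by
  rw [Finset.card_eq_zero.2 (Finset.filter_eq_empty_iff.2 (fun y _ => by
    have := atom_rLab_le_one s hs y; omega))]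
  exact Nat.zero_le _

end Summit.Ventures.PercRepro2.Tail2D
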